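import Literature.Computability.Cryptography.CubicClassTableFPExp
import HarnessLib

/-!
# The class-group table on codes, V: the greedy descent, the guarded baby steps, the ladder class table

Theorem-only sequel of `CubicClassTableFPExp.lean`, concluding the typed polynomial-time computability of the ladder-walk
class table `classTableOpQ` of `CubicClassTableLadder.lean` over `CodeFP` black boxes (cube roots, degree-one prime codes,
lattice product, reduction step) with six-entry lattice outputs, in pointwise form:

* `codeFP_tryMul`, `tryMul_label`, `tryMul_pos`, `tryMul3_inv` — one guarded multiplication by `g_i` (level `i ≤ Tdbl` in
  unary; position growth `≤ 2^Tdbl (s₀ + 1) 2^K`);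
* `codeFP_descend`, `descend_label` — the greedy descent, a fold over the levels `(range Tdbl).reverse` of three guarded
  multiplications, the (binary) level read capped at `Tdbl` so that the step is polynomial on every item (`List.foldl_ext`);
* `codeFP_babyStepc`, `babyStepc_inv`, `codeFP_iterate_babyStepc` — `Bb` clamped guarded baby steps towards `t⋆`;
* **`codeFP_classTableOpQ`** — `s ↦ classTableOpQ (I s) (cap s) (v s)` is computed on codes, for every field of the instance,
  the cap and the position computed from the context (the line's Theorems file reads them off the argument tuple).

## References

* S. Arora, B. Barak, *Computational Complexity: A Modern Approach*, CUP 2009, §1.3. [AroraBarak2009]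
* S. Hallgren, STOC 2005, §4. [Hallgren2005]
* J. Buchmann, H. C. Williams, Math. Comp. 50 (1988), §3. [BuchmannWilliams1988]
-/

namespace Literature.Computability.Cryptography

namespace CubicClassTable

open Literature.Computability.Complexity Literature.Computability.Complexity.CodeFP Polynomial

namespace WalkFns

variable (F : WalkFns)

/-! ### The guarded multiplication and the greedy descent -/

/-- **One guarded multiplication by `g_i` is computed on codes** (pointwise form; target `X`, unary level `i` and state
from the context). [cite: AroraBarak2009, §1.3] -/
theorem codeFP_tryMul {σ : Type} {eσ : σ → List Bool} {I : σ → Inst} {cap i : σ → ℕ} {X : σ → ℤ} {st : σ → PLat}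
    (hlat : CodeFP (pairE (pairE natE natE) (pairE (pairE natE (rawE intE)) (pairE natE (rawE intE)))) (pairE natE (rawE intE)) F.latProd) (hred : CodeFP (pairE (pairE (pairE natE natE) unE) (pairE natE (rawE intE))) (pairE (pairE natE (rawE intE)) intE) F.redL)
    (hlat6 : ∀ x, (F.latProd x).2.length ≤ 6) (hred6 : ∀ x, ((F.redL x).1).2.length ≤ 6)
    (hd : CodeFP eσ (pairE (pairE natE natE) unE) (fun s => (I s).d)) (hord : CodeFP eσ (pairE natE (rawE intE)) (fun s => (I s).ord))
    (hcap : CodeFP eσ natE cap) (hs₀ : CodeFP eσ unE (fun s => (I s).s₀)) (hKInt : CodeFP eσ intE (fun s => (I s).KInt))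
    (hX : CodeFP eσ intE X) (hi : CodeFP eσ unE i) (hst : CodeFP eσ (pairE (pairE natE (rawE intE)) intE) st) :
    CodeFP eσ (pairE (pairE natE (rawE intE)) intE) (fun s => F.tryMul (I s) (cap s) (X s) (i s) (st s)) := by
  have hL := F.codeFP_ladder hlat hred hlat6 hred6 hd hord hcap hs₀ hi
  have hc : CodeFP eσ bitE (fun s => decide ((st s).2 + (F.ladder (I s) (cap s) (i s)).2 + (I s).KInt ≤ X s)) :=
    (intLe.comp ((intAdd.comp ((intAdd.comp (hst.snd'.pair hL.snd')).pair hKInt)).pair hX) :)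
  have hm := F.codeFP_starCc hlat hred hd hord hcap hst hL
  refine ((hc.ite hm hst).congr fun s => ?_)
  unfold tryMul
  by_cases h : (st s).2 + (F.ladder (I s) (cap s) (i s)).2 + (I s).KInt ≤ X s <;> simp [h]

/-- The label of a guarded multiplication from a clamped label is a clamp. [folklore] -/
theorem tryMul_label (hred6 : ∀ x, ((F.redL x).1).2.length ≤ 6) (I : Inst) (cap : ℕ) (X : ℤ) (i : ℕ) (st : PLat)
    (hst : ∃ y : Lat, y.2.length ≤ 6 ∧ st.1 = clampL cap I.ord y) :
    ∃ y : Lat, y.2.length ≤ 6 ∧ (F.tryMul I cap X i st).1 = clampL cap I.ord y := by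
  unfold tryMul
  split_ifs
  · exact F.exists_starCc_fst hred6 I cap _ _
  · exact hst

/-- The position of a guarded multiplication at level `i ≤ Tdbl` grows by at most `2^Tdbl (s₀ + 1) 2^K`. [folklore] -/
theorem tryMul_pos (hlat6 : ∀ x, (F.latProd x).2.length ≤ 6) (hred6 : ∀ x, ((F.redL x).1).2.length ≤ 6) (I : Inst) (cap K : ℕ)
    (hR : ∀ y : Lat, y.2.length ≤ 6 → ((F.redL (I.d, clampL cap I.ord y)).2).natAbs < 2 ^ K) (X : ℤ) {i : ℕ}
    (hi : i ≤ I.Tdbl) (st : PLat) :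
    ((F.tryMul I cap X i st).2).natAbs ≤ (st.2).natAbs + 2 ^ I.Tdbl * ((I.s₀ + 1) * 2 ^ K) := by
  unfold tryMul
  split_ifs
  · have h1 := F.natAbs_starCc_snd_le hlat6 I cap K hR st (F.ladder I cap i)
    have h2 := (F.ladder_inv hlat6 hred6 I cap K hR i).2
    have h3 : 2 ^ i * ((I.s₀ + 1) * 2 ^ K) ≤ 2 ^ I.Tdbl * ((I.s₀ + 1) * 2 ^ K) :=
      Nat.mul_le_mul_right _ (Nat.pow_le_pow_right Nat.two_pos hi)
    generalize 2 ^ i * ((I.s₀ + 1) * 2 ^ K) = A at *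
    generalize 2 ^ I.Tdbl * ((I.s₀ + 1) * 2 ^ K) = A' at *
    generalize 2 ^ K = C at *
    omega
  · exact Nat.le_add_right _ _

/-- Three guarded multiplications at a level `≤ Tdbl`: clamped label, position growth `≤ 3 · 2^Tdbl (s₀ + 1) 2^K`.
[folklore] -/
theorem tryMul3_inv (hlat6 : ∀ x, (F.latProd x).2.length ≤ 6) (hred6 : ∀ x, ((F.redL x).1).2.length ≤ 6) (I : Inst) (cap K : ℕ)
    (hR : ∀ y : Lat, y.2.length ≤ 6 → ((F.redL (I.d, clampL cap I.ord y)).2).natAbs < 2 ^ K) (X : ℤ) {i : ℕ}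
    (hi : i ≤ I.Tdbl) (st : PLat) (hst : ∃ y : Lat, y.2.length ≤ 6 ∧ st.1 = clampL cap I.ord y) :
    (∃ y : Lat, y.2.length ≤ 6 ∧ ((F.tryMul I cap X i)^[3] st).1 = clampL cap I.ord y) ∧
      (((F.tryMul I cap X i)^[3] st).2).natAbs ≤ (st.2).natAbs + 3 * (2 ^ I.Tdbl * ((I.s₀ + 1) * 2 ^ K)) := by
  have hl1 := F.tryMul_label hred6 I cap X i st hst
  have hl2 := F.tryMul_label hred6 I cap X i _ hl1
  have hl3 := F.tryMul_label hred6 I cap X i _ hl2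
  have hp1 := F.tryMul_pos hlat6 hred6 I cap K hR X hi st
  have hp2 := F.tryMul_pos hlat6 hred6 I cap K hR X hi (F.tryMul I cap X i st)
  have hp3 := F.tryMul_pos hlat6 hred6 I cap K hR X hi (F.tryMul I cap X i (F.tryMul I cap X i st))
  rw [show (F.tryMul I cap X i)^[3] st = F.tryMul I cap X i (F.tryMul I cap X i (F.tryMul I cap X i st)) by
    rw [Function.iterate_succ_apply', Function.iterate_succ_apply', Function.iterate_one]]
  refine ⟨hl3, ?_⟩
  generalize 2 ^ I.Tdbl * ((I.s₀ + 1) * 2 ^ K) = A at *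
  omega

/-- `3 (s₀ + 1) ≤ 2^(s₀ + 2)`. [folklore] -/
theorem three_mul_succ_le_two_pow (s₀ : ℕ) : 3 * (s₀ + 1) ≤ 2 ^ (s₀ + 2) := by
  have := s₀.lt_two_pow_self
  rw [pow_add]; norm_num; omega

/-- **The greedy descent is computed on codes** (pointwise form; target `X` and initial state with a clamped label
from the context): a fold over the levels `(range Tdbl).reverse` of three guarded multiplications, the level read in
unary capped at `Tdbl` (so that the step is polynomial on every item). [cite: AroraBarak2009, §1.3; BuchmannWilliams1988, §3] -/
theorem codeFP_descend {σ : Type} {eσ : σ → List Bool} {I : σ → Inst} {cap : σ → ℕ} {Xt : σ → ℤ} {st : σ → PLat}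
    (hlat : CodeFP (pairE (pairE natE natE) (pairE (pairE natE (rawE intE)) (pairE natE (rawE intE)))) (pairE natE (rawE intE)) F.latProd) (hred : CodeFP (pairE (pairE (pairE natE natE) unE) (pairE natE (rawE intE))) (pairE (pairE natE (rawE intE)) intE) F.redL)
    (hlat6 : ∀ x, (F.latProd x).2.length ≤ 6) (hred6 : ∀ x, ((F.redL x).1).2.length ≤ 6)
    (hd : CodeFP eσ (pairE (pairE natE natE) unE) (fun s => (I s).d)) (hord : CodeFP eσ (pairE natE (rawE intE)) (fun s => (I s).ord))
    (hcap : CodeFP eσ natE cap) (hs₀ : CodeFP eσ unE (fun s => (I s).s₀)) (hTdbl : CodeFP eσ unE (fun s => (I s).Tdbl))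
    (hKInt : CodeFP eσ intE (fun s => (I s).KInt)) (hX : CodeFP eσ intE Xt)
    (hst : CodeFP eσ (pairE (pairE natE (rawE intE)) intE) st) (hst1 : ∀ s, ∃ y : Lat, y.2.length ≤ 6 ∧ (st s).1 = clampL (cap s) (I s).ord y) :
    CodeFP eσ (pairE (pairE natE (rawE intE)) intE) (fun s => F.descend (I s) (cap s) (Xt s) (st s)) := by
  obtain ⟨K, hK⟩ := F.exists_logBound hred hd hord hcap
  obtain ⟨Ps, hPs⟩ := exists_length_le_eval hs₀
  obtain ⟨PT, hPT⟩ := exists_length_le_eval hTdbl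
  obtain ⟨Pst, hPst⟩ := exists_length_le_eval hst
  -- the step, context `w = (s, (i, acc))`, level `min i Tdbl` in unary
  have e1 : CodeFP (pairE eσ (pairE natE (pairE (pairE natE (rawE intE)) intE))) eσ (fun w => w.1) := fst _ _
  have hi' : CodeFP (pairE eσ (pairE natE (pairE (pairE natE (rawE intE)) intE))) unE (fun w => min w.2.1 (I w.1).Tdbl) :=
    (unOfNatMin.comp ((hTdbl.comp e1).pair (snd _ _).fst') :)
  have h1 := F.codeFP_tryMul (σ := σ × (ℕ × PLat)) (eσ := pairE eσ (pairE natE (pairE (pairE natE (rawE intE)) intE)))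
    (I := fun w => I w.1) (cap := fun w => cap w.1) (i := fun w => min w.2.1 (I w.1).Tdbl) (X := fun w => Xt w.1) (st := fun w => w.2.2)
    hlat hred hlat6 hred6 (hd.comp e1) (hord.comp e1) (hcap.comp e1) (hs₀.comp e1) (hKInt.comp e1) (hX.comp e1) hi' (snd _ _).snd'
  have h2 := F.codeFP_tryMul (σ := σ × (ℕ × PLat)) (eσ := pairE eσ (pairE natE (pairE (pairE natE (rawE intE)) intE)))
    (I := fun w => I w.1) (cap := fun w => cap w.1) (i := fun w => min w.2.1 (I w.1).Tdbl) (X := fun w => Xt w.1)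
    (st := fun w => F.tryMul (I w.1) (cap w.1) (Xt w.1) (min w.2.1 (I w.1).Tdbl) w.2.2)
    hlat hred hlat6 hred6 (hd.comp e1) (hord.comp e1) (hcap.comp e1) (hs₀.comp e1) (hKInt.comp e1) (hX.comp e1) hi' h1
  have h3 := F.codeFP_tryMul (σ := σ × (ℕ × PLat)) (eσ := pairE eσ (pairE natE (pairE (pairE natE (rawE intE)) intE)))
    (I := fun w => I w.1) (cap := fun w => cap w.1) (i := fun w => min w.2.1 (I w.1).Tdbl) (X := fun w => Xt w.1)
    (st := fun w => F.tryMul (I w.1) (cap w.1) (Xt w.1) (min w.2.1 (I w.1).Tdbl) (F.tryMul (I w.1) (cap w.1) (Xt w.1) (min w.2.1 (I w.1).Tdbl) w.2.2))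
    hlat hred hlat6 hred6 (hd.comp e1) (hord.comp e1) (hcap.comp e1) (hs₀.comp e1) (hKInt.comp e1) (hX.comp e1) hi' h2
  have hstep : CodeFP (pairE eσ (pairE natE (pairE (pairE natE (rawE intE)) intE))) (pairE (pairE natE (rawE intE)) intE)
      (fun w => (F.tryMul (I w.1) (cap w.1) (Xt w.1) (min w.2.1 (I w.1).Tdbl))^[3] w.2.2) :=
    h3.congr fun w => by rw [Function.iterate_succ_apply', Function.iterate_succ_apply', Function.iterate_one]
  have hl : CodeFP eσ (rawE natE) (fun s => (List.range (I s).Tdbl).reverse) := ((rawReverse natE).comp (urange.comp hTdbl) :)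
  have h := foldlInv (eσ := eσ) (eα := natE) (eβ := pairE (pairE natE (rawE intE)) intE)
    (step := fun s i acc => (F.tryMul (I s) (cap s) (Xt s) (min i (I s).Tdbl))^[3] acc)
    (init := st) (l := fun s => (List.range (I s).Tdbl).reverse)
    (fun s j x => (∃ y : Lat, y.2.length ≤ 6 ∧ x.1 = clampL (cap s) (I s).ord y) ∧
      (x.2).natAbs ≤ ((st s).2).natAbs + j * (3 * (2 ^ (I s).Tdbl * (((I s).s₀ + 1) * 2 ^ K.eval (eσ s).length))))
    hstep hst hl (fun s => ⟨hst1 s, by simp⟩)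
    (fun s j i x hx => by
      have h := F.tryMul3_inv hlat6 hred6 (I s) (cap s) _ (hK s).2 (Xt s) (min_le_right i (I s).Tdbl) x hx.1
      refine ⟨h.1, h.2.trans ?_⟩
      have := hx.2
      generalize 3 * (2 ^ (I s).Tdbl * (((I s).s₀ + 1) * 2 ^ K.eval (eσ s).length)) = A at *
      rw [Nat.succ_mul]; omega)
    (4 * K + 2 * Pst + 2 * PT + 2 * Ps + 4 * X + 16)
    (fun s j x hx => by
      have hs0 : (I s).s₀ ≤ Ps.eval (eσ s).length := by have := hPs s; rwa [length_unE] at this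
      have hT : (I s).Tdbl ≤ PT.eval (eσ s).length := by have := hPT s; rwa [length_unE] at this
      have hst2 : ((st s).2).natAbs < 2 ^ Pst.eval (eσ s).length := by
        refine lt_of_lt_of_le (IntWalkOps.natAbs_lt_two_pow_length _) (Nat.pow_le_pow_right Nat.two_pos (le_trans ?_ (hPst s)))
        rw [length_pairE]; omega
      have hA : 3 * (2 ^ (I s).Tdbl * (((I s).s₀ + 1) * 2 ^ K.eval (eσ s).length)) ≤ 2 ^ ((I s).Tdbl + (I s).s₀ + 2 + K.eval (eσ s).length) := by
        have := three_mul_succ_le_two_pow (I s).s₀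
        calc 3 * (2 ^ (I s).Tdbl * (((I s).s₀ + 1) * 2 ^ K.eval (eσ s).length))
            = 2 ^ (I s).Tdbl * (3 * ((I s).s₀ + 1)) * 2 ^ K.eval (eσ s).length := by ring
          _ ≤ 2 ^ (I s).Tdbl * 2 ^ ((I s).s₀ + 2) * 2 ^ K.eval (eσ s).length :=
            Nat.mul_le_mul_right _ (Nat.mul_le_mul_left _ this)
          _ = 2 ^ ((I s).Tdbl + (I s).s₀ + 2 + K.eval (eσ s).length) := by rw [← pow_add, ← pow_add]; ring
      have hx2 : (x.2).natAbs ≤ 2 ^ 0 * ((j + 1) * 2 ^ (Pst.eval (eσ s).length + ((I s).Tdbl + (I s).s₀ + 2 + K.eval (eσ s).length))) := by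
        rw [pow_zero, one_mul, Nat.succ_mul, pow_add 2 (Pst.eval (eσ s).length)]
        have h1 : ((st s).2).natAbs ≤ 2 ^ Pst.eval (eσ s).length * 2 ^ ((I s).Tdbl + (I s).s₀ + 2 + K.eval (eσ s).length) :=
          hst2.le.trans (Nat.le_mul_of_pos_right _ (Nat.pow_pos Nat.two_pos))
        have h2 : j * (3 * (2 ^ (I s).Tdbl * (((I s).s₀ + 1) * 2 ^ K.eval (eσ s).length))) ≤
            j * (2 ^ Pst.eval (eσ s).length * 2 ^ ((I s).Tdbl + (I s).s₀ + 2 + K.eval (eσ s).length)) :=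
          Nat.mul_le_mul_left _ (hA.trans (Nat.le_mul_of_pos_left _ (Nat.pow_pos Nat.two_pos)))
        have := hx.2
        generalize 3 * (2 ^ (I s).Tdbl * (((I s).s₀ + 1) * 2 ^ K.eval (eσ s).length)) = A at *
        generalize 2 ^ Pst.eval (eσ s).length * 2 ^ ((I s).Tdbl + (I s).s₀ + 2 + K.eval (eσ s).length) = B at *
        omega
      have hlen := length_PLatE_le (hK s).1 hx.1 hx2
      have hsz : ((j + 1) * 2 ^ (Pst.eval (eσ s).length + ((I s).Tdbl + (I s).s₀ + 2 + K.eval (eσ s).length))).size ≤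
          (j + 1) + (Pst.eval (eσ s).length + ((I s).Tdbl + (I s).s₀ + 2 + K.eval (eσ s).length)) :=
        (IntWalkOps.size_mul_two_pow_le _ _).trans (Nat.add_le_add_right (Nat.size_le.2 (Nat.lt_two_pow_self)) _)
      have hm1 : K.eval (eσ s).length ≤ K.eval ((eσ s).length + j) := TM2Iter.eval_mono K (by omega)
      have hm2 : Ps.eval (eσ s).length ≤ Ps.eval ((eσ s).length + j) := TM2Iter.eval_mono Ps (by omega)
      have hm3 : PT.eval (eσ s).length ≤ PT.eval ((eσ s).length + j) := TM2Iter.eval_mono PT (by omega)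
      have hm4 : Pst.eval (eσ s).length ≤ Pst.eval ((eσ s).length + j) := TM2Iter.eval_mono Pst (by omega)
      simp only [eval_add, eval_mul, eval_ofNat, eval_X]
      omega)
  refine h.congr fun s => ?_
  unfold descend
  refine List.foldl_ext _ _ _ fun acc i hi => ?_
  rw [min_eq_left (le_of_lt (List.mem_range.1 (List.mem_reverse.1 hi)))]

/-- The label after the descent from a clamped label is a clamp. [folklore] -/
theorem descend_label (hred6 : ∀ x, ((F.redL x).1).2.length ≤ 6) (I : Inst) (cap : ℕ) (X : ℤ) (st : PLat)
    (hst : ∃ y : Lat, y.2.length ≤ 6 ∧ st.1 = clampL cap I.ord y) :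
    ∃ y : Lat, y.2.length ≤ 6 ∧ (F.descend I cap X st).1 = clampL cap I.ord y := by
  unfold descend
  induction (List.range I.Tdbl).reverse using List.reverseRecOn with
  | nil => exact hst
  | append_singleton l i ih =>
    rw [List.foldl_append, List.foldl_cons, List.foldl_nil, Function.iterate_succ_apply', Function.iterate_succ_apply',
      Function.iterate_one]
    exact F.tryMul_label hred6 I cap X i _ (F.tryMul_label hred6 I cap X i _ (F.tryMul_label hred6 I cap X i _ ih))

/-! ### The guarded baby steps -/

/-- **One clamped guarded baby step is computed on codes** (pointwise form; the target `t⋆` and the state from the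
context). [cite: AroraBarak2009, §1.3] -/
theorem codeFP_babyStepc {σ : Type} {eσ : σ → List Bool} {I : σ → Inst} {cap v : σ → ℕ} {st : σ → PLat}
    (hred : CodeFP (pairE (pairE (pairE natE natE) unE) (pairE natE (rawE intE))) (pairE (pairE natE (rawE intE)) intE) F.redL)
    (hd : CodeFP eσ (pairE (pairE natE natE) unE) (fun s => (I s).d)) (hord : CodeFP eσ (pairE natE (rawE intE)) (fun s => (I s).ord))
    (hcap : CodeFP eσ natE cap) (htstar : CodeFP eσ intE (fun s => F.tstarc (I s) (cap s) (v s)))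
    (hst : CodeFP eσ (pairE (pairE natE (rawE intE)) intE) st) :
    CodeFP eσ (pairE (pairE natE (rawE intE)) intE) (fun s => F.babyStepc (I s) (cap s) (v s) (st s)) := by
  have hrc := F.codeFP_redc hred hd hord hcap hst.fst'
  have hpos : CodeFP eσ intE (fun s => (st s).2 + (F.redc (I s) (cap s) (st s).1).2) := (intAdd.comp (hst.snd'.pair hrc.snd') :)
  have hc : CodeFP eσ bitE (fun s => decide ((st s).2 + (F.redc (I s) (cap s) (st s).1).2 ≤ F.tstarc (I s) (cap s) (v s))) :=
    (intLe.comp (hpos.pair htstar) :)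
  refine (((hc.ite (hrc.fst'.pair hpos) hst).congr fun s => ?_) :)
  unfold babyStepc
  by_cases h : (st s).2 + (F.redc (I s) (cap s) (st s).1).2 ≤ F.tstarc (I s) (cap s) (v s) <;> simp [h]

/-- Guarded baby steps from a clamped label: clamped label, position growth `≤ 2^K` per step. [folklore] -/
theorem babyStepc_inv (hred6 : ∀ x, ((F.redL x).1).2.length ≤ 6) (I : Inst) (cap K : ℕ)
    (hR : ∀ y : Lat, y.2.length ≤ 6 → ((F.redL (I.d, clampL cap I.ord y)).2).natAbs < 2 ^ K) (v : ℕ) (st : PLat)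
    (hst : ∃ y : Lat, y.2.length ≤ 6 ∧ st.1 = clampL cap I.ord y) :
    (∃ y : Lat, y.2.length ≤ 6 ∧ (F.babyStepc I cap v st).1 = clampL cap I.ord y) ∧
      ((F.babyStepc I cap v st).2).natAbs ≤ (st.2).natAbs + 2 ^ K := by
  unfold babyStepc
  split_ifs
  · exact ⟨⟨_, hred6 _, rfl⟩, F.stepc_pos I cap K hR st hst⟩
  · exact ⟨hst, Nat.le_add_right _ _⟩

/-- **The final state of the ladder walk is computed on codes** (pointwise form; `Bb` unary): `Bb` clamped guarded baby
steps from a computed state with a clamped label. [cite: AroraBarak2009, §1.3] -/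
theorem codeFP_iterate_babyStepc {σ : Type} {eσ : σ → List Bool} {I : σ → Inst} {cap v : σ → ℕ} {st : σ → PLat}
    (hred : CodeFP (pairE (pairE (pairE natE natE) unE) (pairE natE (rawE intE))) (pairE (pairE natE (rawE intE)) intE) F.redL)
    (hred6 : ∀ x, ((F.redL x).1).2.length ≤ 6)
    (hd : CodeFP eσ (pairE (pairE natE natE) unE) (fun s => (I s).d)) (hord : CodeFP eσ (pairE natE (rawE intE)) (fun s => (I s).ord))
    (hcap : CodeFP eσ natE cap) (hBb : CodeFP eσ unE (fun s => (I s).Bb)) (htstar : CodeFP eσ intE (fun s => F.tstarc (I s) (cap s) (v s)))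
    (hst : CodeFP eσ (pairE (pairE natE (rawE intE)) intE) st) (hst1 : ∀ s, ∃ y : Lat, y.2.length ≤ 6 ∧ (st s).1 = clampL (cap s) (I s).ord y) :
    CodeFP eσ (pairE (pairE natE (rawE intE)) intE) (fun s => (F.babyStepc (I s) (cap s) (v s))^[(I s).Bb] (st s)) := by
  obtain ⟨K, hK⟩ := F.exists_logBound hred hd hord hcap
  obtain ⟨Pst, hPst⟩ := exists_length_le_eval hst
  have hF : CodeFP (pairE eσ (pairE (pairE natE (rawE intE)) intE)) (pairE (pairE natE (rawE intE)) intE)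
      (fun t => F.babyStepc (I t.1) (cap t.1) (v t.1) t.2) :=
    F.codeFP_babyStepc (σ := σ × PLat) (eσ := pairE eσ (pairE (pairE natE (rawE intE)) intE)) (I := fun t => I t.1)
      (cap := fun t => cap t.1) (v := fun t => v t.1) (st := fun t => t.2) hred (hd.comp (fst _ _)) (hord.comp (fst _ _))
      (hcap.comp (fst _ _)) (htstar.comp (fst _ _)) (snd _ _)
  exact iterateInv (eσ := eσ) (eβ := pairE (pairE natE (rawE intE)) intE) (F := fun s x => F.babyStepc (I s) (cap s) (v s) x)
    (init := st) (k := fun s => (I s).Bb)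
    (fun s j x => (∃ y : Lat, y.2.length ≤ 6 ∧ x.1 = clampL (cap s) (I s).ord y) ∧ (x.2).natAbs ≤ ((st s).2).natAbs + j * 2 ^ K.eval (eσ s).length)
    hF hst hBb (fun s => ⟨hst1 s, by simp⟩)
    (fun s j x hx => by
      have h := F.babyStepc_inv hred6 (I s) (cap s) _ (hK s).2 (v s) x hx.1
      refine ⟨h.1, h.2.trans ?_⟩
      have := hx.2
      generalize 2 ^ K.eval (eσ s).length = C at *
      rw [Nat.succ_mul]; omega)
    (4 * K + 2 * Pst + 4 * X + 8)
    (fun s j x hx => by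
      have hst2 : ((st s).2).natAbs < 2 ^ Pst.eval (eσ s).length := by
        refine lt_of_lt_of_le (IntWalkOps.natAbs_lt_two_pow_length _) (Nat.pow_le_pow_right Nat.two_pos (le_trans ?_ (hPst s)))
        rw [length_pairE]; omega
      have hx2 : (x.2).natAbs ≤ 2 ^ 0 * ((j + 1) * 2 ^ (Pst.eval (eσ s).length + K.eval (eσ s).length)) := by
        rw [pow_zero, one_mul, Nat.succ_mul, pow_add]
        have h1 : ((st s).2).natAbs ≤ 2 ^ Pst.eval (eσ s).length * 2 ^ K.eval (eσ s).length :=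
          hst2.le.trans (Nat.le_mul_of_pos_right _ (Nat.pow_pos Nat.two_pos))
        have h2 : j * 2 ^ K.eval (eσ s).length ≤ j * (2 ^ Pst.eval (eσ s).length * 2 ^ K.eval (eσ s).length) :=
          Nat.mul_le_mul_left _ (Nat.le_mul_of_pos_left _ (Nat.pow_pos Nat.two_pos))
        have := hx.2
        generalize 2 ^ Pst.eval (eσ s).length * 2 ^ K.eval (eσ s).length = B at *
        generalize 2 ^ K.eval (eσ s).length = C at *
        omega
      have hlen := length_PLatE_le (hK s).1 hx.1 hx2
      have hsz : ((j + 1) * 2 ^ (Pst.eval (eσ s).length + K.eval (eσ s).length)).size ≤ (j + 1) + (Pst.eval (eσ s).length + K.eval (eσ s).length) :=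
        (IntWalkOps.size_mul_two_pow_le _ _).trans (Nat.add_le_add_right (Nat.size_le.2 (Nat.lt_two_pow_self)) _)
      have hm1 : K.eval (eσ s).length ≤ K.eval ((eσ s).length + j) := TM2Iter.eval_mono K (by omega)
      have hm4 : Pst.eval (eσ s).length ≤ Pst.eval ((eσ s).length + j) := TM2Iter.eval_mono Pst (by omega)
      simp only [eval_add, eval_mul, eval_ofNat, eval_X]
      omega)

/-! ### The table -/

/-- **The ladder class table is computed on codes** (pointwise form): for `CodeFP` black boxes with six-entry lattice
outputs and every field of the instance, the cap and the position computed from the context (`a b m r margin cap v`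
binary, `ps` a raw list, `ord` a lattice code, `k prec s ℓe npp ℓy ℓκ ℓb s₀ Tdbl Bb` unary), `s ↦ classTableOpQ (I s) (cap s) (v s)`
is computed on codes by a polynomial-time string function. [cite: AroraBarak2009, §1.3; Hallgren2005, §4; BuchmannWilliams1988, §3] -/
theorem codeFP_classTableOpQ {σ : Type} {eσ : σ → List Bool} {I : σ → Inst} {cap v : σ → ℕ}
    (hroots : CodeFP (pairE natE (pairE natE strE)) (rawE natE) F.roots) (hprime : CodeFP (pairE (pairE natE natE) (pairE (pairE natE (rawE intE)) (pairE natE natE))) (pairE natE (rawE intE)) F.primeL)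
    (hlat : CodeFP (pairE (pairE natE natE) (pairE (pairE natE (rawE intE)) (pairE natE (rawE intE)))) (pairE natE (rawE intE)) F.latProd) (hred : CodeFP (pairE (pairE (pairE natE natE) unE) (pairE natE (rawE intE))) (pairE (pairE natE (rawE intE)) intE) F.redL)
    (hlat6 : ∀ x, (F.latProd x).2.length ≤ 6) (hred6 : ∀ x, ((F.redL x).1).2.length ≤ 6)
    (ha : CodeFP eσ natE (fun s => (I s).a)) (hb : CodeFP eσ natE (fun s => (I s).b)) (hm : CodeFP eσ natE (fun s => (I s).m))
    (hps : CodeFP eσ (rawE natE) (fun s => (I s).ps)) (hord : CodeFP eσ (pairE natE (rawE intE)) (fun s => (I s).ord))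
    (hr : CodeFP eσ natE (fun s => (I s).r)) (hk : CodeFP eσ unE (fun s => (I s).k)) (hprec : CodeFP eσ unE (fun s => (I s).prec))
    (hs : CodeFP eσ unE (fun s => (I s).s)) (hℓe : CodeFP eσ unE (fun s => (I s).ℓe)) (hnpp : CodeFP eσ unE (fun s => (I s).npp))
    (hℓy : CodeFP eσ unE (fun s => (I s).ℓy)) (hℓκ : CodeFP eσ unE (fun s => (I s).ℓκ)) (hℓb : CodeFP eσ unE (fun s => (I s).ℓb))
    (hs₀ : CodeFP eσ unE (fun s => (I s).s₀)) (hTdbl : CodeFP eσ unE (fun s => (I s).Tdbl)) (hBb : CodeFP eσ unE (fun s => (I s).Bb))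
    (hmargin : CodeFP eσ natE (fun s => (I s).margin)) (hcap : CodeFP eσ natE cap) (hv : CodeFP eσ natE v) :
    CodeFP eσ (pairE (pairE natE (rawE intE)) natE) (fun s => F.classTableOpQ (I s) (cap s) (v s)) := by
  have hd : CodeFP eσ (pairE (pairE natE natE) unE) (fun s => (I s).d) := ((ha.pair hb).pair hprec).congr fun s => rfl
  have hbEc := F.codeFP_bEc hroots hprime hlat hred hlat6 hred6 hd hord hcap hm hps hℓe hℓy hℓκ hℓb hv
  have hΔ := F.codeFP_Δc hbEc hps hℓe hℓy hr hk hprec hs hv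
  have htstar := F.codeFP_tstarc hbEc hΔ
  have hX : CodeFP eσ intE (fun s => F.tstarc (I s) (cap s) (v s) - ((I s).margin : ℤ)) := (intSub.comp (htstar.pair (intOfNat.comp hmargin)) :)
  have hc0 : CodeFP eσ (pairE (pairE natE (rawE intE)) intE) (fun s => F.c0q (I s) (cap s) (v s)) :=
    (F.codeFP_descend hlat hred hlat6 hred6 hd hord hcap hs₀ hTdbl (codeFP_KInt ha hb hprec) hX hbEc
      (fun s => F.bEc_label hred6 (I s) (cap s) (v s))).congr fun s => rfl
  have hfin : CodeFP eσ (pairE (pairE natE (rawE intE)) intE) (fun s => F.cfinq (I s) (cap s) (v s)) :=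
    (F.codeFP_iterate_babyStepc hred hred6 hd hord hcap hBb htstar hc0
      (fun s => F.descend_label hred6 (I s) (cap s) _ _ (F.bEc_label hred6 (I s) (cap s) (v s)))).congr fun s => rfl
  have hcell : CodeFP eσ natE (fun s => (F.tstarc (I s) (cap s) (v s) - (F.cfinq (I s) (cap s) (v s)).2).toNat / 2 ^ ((I s).prec - (I s).npp)) :=
    (natDiv.comp ((intToNat.comp (intSub.comp (htstar.pair hfin.snd'))).pair (natPow.comp ((const eσ (2 : ℕ)).pair (MachineA.unSub.comp (hprec.pair hnpp))))) :)
  exact ((hfin.fst'.pair hcell).congr fun s => rfl :)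

end WalkFns

end CubicClassTable

end Literature.Computability.Cryptography
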